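import Literature.Analysis.FluidPDE.SereginSverakPressureMonotone
import HarnessLib

/-!
# The truncated probe test function: a compactly supported cut-off of `r⁻¹ P̄(|x - x₀|²/r²)`
# with scale-invariant bounds on its gradient and Laplacian

Analysis/FluidPDE proof file (theorems only; no definitions, no named facts) on the discharge
path of the named fact `Literature.Analysis.FluidPDE.seregin_sverak_2002`
(`SereginSverakPressure.lean`; G. Seregin, V. Šverák, Arch. Ration. Mech. Anal. **163** (2002)
65–86). The probe-smoothed scaled energy of `SereginSverakPressureMonotone.lean`,
`F(r; x₀) = ∫ |u|² r⁻¹ P̄(|x - x₀|²/r²)`, is an integral against a smooth weight which is NOT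
compactly supported (`P̄(σ) = P̄(1) σ^{-3/2}` for `σ ≥ 1`). To feed it into the local energy
identity of a classical solution (`ClassicalLocalEnergyCutoff.lean`,
`ClassicalLocalEnergyNoJump.lean`, compactly supported cut-offs) one truncates it at
`|x - x₀| ∼ L r`:

  `φ(x) = r⁻¹ P̄(|x - x₀|²/r²) · X(|x - x₀|²/(L² r²))`,  `X = cutoffProfile 1 2`
  (`X = 1` on `[0, 1]`, `X = 0` on `[4, ∞)`).

This file proves, for a smooth `0 ≤ P̄ ≤ 1` and `L ≥ 1`, with a constant `C = C(P̄, L)`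
INDEPENDENT of the scale `r > 0` and the centre `x₀`
(`SereginSverak2002.exists_probeCutoff_bounds`): `φ ∈ C_c^∞`, `0 ≤ φ ≤ r⁻¹`,
`tsupport φ ⊆ B̄(x₀, 2Lr)`, `φ = r⁻¹ P̄(|x - x₀|²/r²)` on `B̄(x₀, Lr)`, `‖Dφ(x)‖ ≤ C r⁻²` and
`|Δφ(x)| ≤ C r⁻³` — the scale-invariant sizes of a test function "of height `r⁻¹` at scale
`r`", which make the three flux quantities of `ClassicalLocalEnergyNoJump.lean` dimensionless.
The computation is `φ = g(|x - x₀|²)` with `g(σ) = r⁻¹ H(σ/r²)`, `H = P̄ · X(·/L²)`: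
`Dφ(x) a = 2 g'(σ) ⟪x - x₀, a⟫`, `Δφ(x) = 4 g''(σ) σ + 6 g'(σ)` (the tree's
`laplacian_comp_norm_sq_fin3`), `g' = r⁻³ H'(σ/r²)`, `g'' = r⁻⁵ H''(σ/r²)`, and `H', H''` are
continuous with support in `[1/4, 4L²]`, hence bounded.

## References

* G. Seregin, V. Šverák, Arch. Ration. Mech. Anal. 163 (2002), 65–86 (the result served).
  [SereginSverak2002]
* L. Caffarelli, R. Kohn, L. Nirenberg, CPAM 35 (1982), §2 (cut-offs at scale `r` with
  `|∇φ| ≤ C/r²`-type bounds in the local energy inequality). [CaffarelliKohnNirenberg1982]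
-/

noncomputable section

open MeasureTheory Set Function Filter Metric Real
open _root_.Topology
open scoped NNReal ENNReal RealInnerProductSpace ContDiff Laplacian

namespace Literature.Analysis.FluidPDE

namespace SereginSverak2002

variable {Pb : ℝ → ℝ}

/-! ### One-variable calculus of the profile `H = P̄ · X(·/L²)` -/

/-- **The truncated profile** `H(τ) = P̄(τ) X(τ/L²)` of a smooth `P̄` with `P̄ = 1` on
`τ ≤ 1/4` is smooth, equals `P̄` on `τ ≤ L²`, vanishes for `τ ≥ 4L²`, is constant `= 1` on
`τ ≤ 1/4` (`L ≥ 1`), and its first two derivatives are bounded. [folklore] -/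
theorem exists_truncatedProfile_bounds (hPb : ContDiff ℝ ∞ Pb)
    (hPb1 : ∀ σ, σ ≤ 1 / 4 → Pb σ = 1) {L : ℝ} (hL : 1 ≤ L) :
    ∃ C : ℝ, 0 ≤ C ∧
      (∀ τ, |deriv (fun τ => Pb τ * cutoffProfile 1 2 (τ / L ^ 2)) τ| ≤ C) ∧
      (∀ τ, |deriv (deriv (fun τ => Pb τ * cutoffProfile 1 2 (τ / L ^ 2))) τ| ≤ C) ∧
      (∀ τ, 4 * L ^ 2 < τ → deriv (fun τ => Pb τ * cutoffProfile 1 2 (τ / L ^ 2)) τ = 0) ∧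
      (∀ τ, 4 * L ^ 2 < τ →
        deriv (deriv (fun τ => Pb τ * cutoffProfile 1 2 (τ / L ^ 2))) τ = 0) := by
  set H : ℝ → ℝ := fun τ => Pb τ * cutoffProfile 1 2 (τ / L ^ 2) with hH
  have hL0 : 0 < L := by linarith
  have hXc : ContDiff ℝ ∞ (cutoffProfile 1 2) := cutoffProfile_contDiff _ _
  have hHc : ContDiff ℝ ∞ H := hPb.mul (hXc.comp (contDiff_id.div_const _))
  have hX1 : ∀ τ, τ ≤ 1 → cutoffProfile 1 2 τ = 1 := fun τ hτ =>
    cutoffProfile_eq_one zero_le_one one_lt_two (by simpa using hτ)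
  have hX0 : ∀ τ, 4 ≤ τ → cutoffProfile 1 2 τ = 0 := fun τ hτ =>
    cutoffProfile_eq_zero zero_le_one one_lt_two (by norm_num; linarith)
  -- `H = 1` on `τ < 1/4`, `H = 0` on `τ > 4L²`
  have hHlo : ∀ τ, τ < 1 / 4 → H =ᶠ[𝓝 τ] fun _ => 1 := by
    intro τ hτ
    filter_upwards [Iio_mem_nhds hτ] with s hs
    have hs0 : s < 1 / 4 := mem_Iio.1 hs
    simp only [hH]
    have hs' : s / L ^ 2 ≤ 1 := by
      rw [div_le_one (by positivity)]
      nlinarith [hs0.le]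
    rw [hPb1 s hs0.le, hX1 _ hs', one_mul]
  have hHhi : ∀ τ, 4 * L ^ 2 < τ → H =ᶠ[𝓝 τ] fun _ => 0 := by
    intro τ hτ
    filter_upwards [Ioi_mem_nhds hτ] with s hs
    have hs0 : 4 * L ^ 2 < s := mem_Ioi.1 hs
    simp only [hH]
    have hs' : 4 ≤ s / L ^ 2 := by
      rw [le_div_iff₀ (by positivity)]
      linarith [hs0.le]
    rw [hX0 _ hs', mul_zero]
  -- the first derivative and its support
  have hd1c : ContDiff ℝ ∞ (deriv H) := (contDiff_infty_iff_deriv.mp hHc).2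
  have hd1lo : ∀ τ, τ < 1 / 4 → deriv H τ = 0 := fun τ hτ => by
    rw [(hHlo τ hτ).deriv_eq, deriv_const]
  have hd1hi : ∀ τ, 4 * L ^ 2 < τ → deriv H τ = 0 := fun τ hτ => by
    rw [(hHhi τ hτ).deriv_eq, deriv_const]
  -- locally constant derivative off `[1/4, 4L²]`, hence second derivative vanishes there too
  have hd1lo' : ∀ τ, τ < 1 / 4 → deriv H =ᶠ[𝓝 τ] fun _ => 0 := fun τ hτ => by
    filter_upwards [Iio_mem_nhds hτ] with s hs using hd1lo s hs
  have hd1hi' : ∀ τ, 4 * L ^ 2 < τ → deriv H =ᶠ[𝓝 τ] fun _ => 0 := fun τ hτ => by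
    filter_upwards [Ioi_mem_nhds hτ] with s hs using hd1hi s hs
  have hd2lo : ∀ τ, τ < 1 / 4 → deriv (deriv H) τ = 0 := fun τ hτ => by
    rw [(hd1lo' τ hτ).deriv_eq, deriv_const]
  have hd2hi : ∀ τ, 4 * L ^ 2 < τ → deriv (deriv H) τ = 0 := fun τ hτ => by
    rw [(hd1hi' τ hτ).deriv_eq, deriv_const]
  -- compact supports and bounds
  have hK : IsCompact (Icc (0 : ℝ) (4 * L ^ 2 + 1)) := isCompact_Icc
  have hs1 : HasCompactSupport (deriv H) := by
    refine HasCompactSupport.intro hK fun τ hτ => ?_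
    rw [mem_Icc, not_and_or, not_le, not_le] at hτ
    rcases hτ with h | h
    · exact hd1lo τ (by linarith)
    · exact hd1hi τ (by linarith)
  have hs2 : HasCompactSupport (deriv (deriv H)) := by
    refine HasCompactSupport.intro hK fun τ hτ => ?_
    rw [mem_Icc, not_and_or, not_le, not_le] at hτ
    rcases hτ with h | h
    · exact hd2lo τ (by linarith)
    · exact hd2hi τ (by linarith)
  obtain ⟨C₁, hC₁⟩ := hd1c.continuous.bounded_above_of_compact_support hs1
  obtain ⟨C₂, hC₂⟩ := (contDiff_infty_iff_deriv.mp hd1c).2.continuous.bounded_above_of_compact_support hs2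
  refine ⟨max C₁ C₂, (norm_nonneg _).trans ((hC₁ 0).trans (le_max_left _ _)),
    fun τ => ?_, fun τ => ?_, hd1hi, hd2hi⟩
  · have := hC₁ τ
    rw [Real.norm_eq_abs] at this
    exact this.trans (le_max_left _ _)
  · have := hC₂ τ
    rw [Real.norm_eq_abs] at this
    exact this.trans (le_max_right _ _)

/-! ### The test function `φ(x) = r⁻¹ H(|x - x₀|²/r²)` -/

/-- The derivative of `w ↦ g(|w|²)` in a direction: `D(g ∘ |·|²)(z) a = 2 g'(|z|²) ⟪z, a⟫`.
[folklore] -/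
theorem fderiv_comp_norm_sq_apply {g g₁ : ℝ → ℝ} (hg : ∀ σ, HasDerivAt g (g₁ σ) σ)
    (z a : EuclideanSpace ℝ (Fin 3)) :
    fderiv ℝ (fun w : EuclideanSpace ℝ (Fin 3) => g (‖w‖ ^ 2)) z a = 2 * g₁ (‖z‖ ^ 2) * ⟪z, a⟫ := by
  have h1 : HasFDerivAt (fun w : EuclideanSpace ℝ (Fin 3) => ‖w‖ ^ 2) (2 • innerSL ℝ z) z :=
    (hasStrictFDerivAt_norm_sq z).hasFDerivAt
  have h2 : HasDerivAt g (g₁ (‖z‖ ^ 2)) (‖z‖ ^ 2) := hg _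
  have h3 := h2.hasFDerivAt.comp z h1
  rw [show (fun w : EuclideanSpace ℝ (Fin 3) => g (‖w‖ ^ 2)) = g ∘ fun w => ‖w‖ ^ 2 from rfl,
    h3.fderiv]
  simp only [ContinuousLinearMap.comp_apply, smul_apply, innerSL_apply_apply, nsmul_eq_mul,
    Nat.cast_ofNat]
  rw [ContinuousLinearMap.toSpanSingleton_apply, smul_eq_mul]
  ring

/-- **The truncated probe test function and its scale-invariant bounds.** For a smooth
`0 ≤ P̄ ≤ 1` with `P̄ = 1` on `σ ≤ 1/4` and `L ≥ 1` there is `C = C(P̄, L) ≥ 0` such that for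
every scale `r > 0` and centre `x₀ ∈ ℝ³` the function
`φ(x) = r⁻¹ P̄(|x - x₀|²/r²) X(|x - x₀|²/r²/L²)` (`X = cutoffProfile 1 2`) is smooth with compact
support, `0 ≤ φ ≤ r⁻¹`, `tsupport φ ⊆ B̄(x₀, 2Lr)`, `φ(x) = r⁻¹ P̄(|x - x₀|²/r²)` for
`|x - x₀| ≤ Lr`, `‖Dφ(x)‖ ≤ C r⁻²` and `|Δφ(x)| ≤ C r⁻³`. [folklore] -/
theorem exists_probeCutoff_bounds (hPb : ContDiff ℝ ∞ Pb) (hPbnn : ∀ σ, 0 ≤ Pb σ)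
    (hPble : ∀ σ, Pb σ ≤ 1) (hPb1 : ∀ σ, σ ≤ 1 / 4 → Pb σ = 1) {L : ℝ} (hL : 1 ≤ L) :
    ∃ C : ℝ, 0 ≤ C ∧ ∀ (r : ℝ), 0 < r → ∀ (x₀ : EuclideanSpace ℝ (Fin 3)),
      ContDiff ℝ ∞ (fun x : EuclideanSpace ℝ (Fin 3) =>
          r⁻¹ * (Pb (‖x - x₀‖ ^ 2 / r ^ 2) * cutoffProfile 1 2 (‖x - x₀‖ ^ 2 / r ^ 2 / L ^ 2))) ∧
      HasCompactSupport (fun x : EuclideanSpace ℝ (Fin 3) =>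
          r⁻¹ * (Pb (‖x - x₀‖ ^ 2 / r ^ 2) * cutoffProfile 1 2 (‖x - x₀‖ ^ 2 / r ^ 2 / L ^ 2))) ∧
      (∀ x : EuclideanSpace ℝ (Fin 3),
          0 ≤ r⁻¹ * (Pb (‖x - x₀‖ ^ 2 / r ^ 2) * cutoffProfile 1 2 (‖x - x₀‖ ^ 2 / r ^ 2 / L ^ 2))) ∧
      (∀ x : EuclideanSpace ℝ (Fin 3),
          r⁻¹ * (Pb (‖x - x₀‖ ^ 2 / r ^ 2) * cutoffProfile 1 2 (‖x - x₀‖ ^ 2 / r ^ 2 / L ^ 2)) ≤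
            r⁻¹) ∧
      tsupport (fun x : EuclideanSpace ℝ (Fin 3) =>
          r⁻¹ * (Pb (‖x - x₀‖ ^ 2 / r ^ 2) * cutoffProfile 1 2 (‖x - x₀‖ ^ 2 / r ^ 2 / L ^ 2))) ⊆
        closedBall x₀ (2 * L * r) ∧
      (∀ x : EuclideanSpace ℝ (Fin 3), ‖x - x₀‖ ≤ L * r →
          r⁻¹ * (Pb (‖x - x₀‖ ^ 2 / r ^ 2) * cutoffProfile 1 2 (‖x - x₀‖ ^ 2 / r ^ 2 / L ^ 2)) =
            r⁻¹ * Pb (‖x - x₀‖ ^ 2 / r ^ 2)) ∧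
      (∀ x : EuclideanSpace ℝ (Fin 3), ‖fderiv ℝ (fun x : EuclideanSpace ℝ (Fin 3) =>
          r⁻¹ * (Pb (‖x - x₀‖ ^ 2 / r ^ 2) * cutoffProfile 1 2 (‖x - x₀‖ ^ 2 / r ^ 2 / L ^ 2))) x‖ ≤
            C / r ^ 2) ∧
      (∀ x : EuclideanSpace ℝ (Fin 3), |(Δ (fun x : EuclideanSpace ℝ (Fin 3) =>
          r⁻¹ * (Pb (‖x - x₀‖ ^ 2 / r ^ 2) * cutoffProfile 1 2 (‖x - x₀‖ ^ 2 / r ^ 2 / L ^ 2)))) x| ≤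
            C / r ^ 3) := by
  obtain ⟨C, hC0, hC1, hC2, hd1hi, hd2hi⟩ := exists_truncatedProfile_bounds hPb hPb1 hL
  have hL0 : 0 < L := by linarith
  set H : ℝ → ℝ := fun τ => Pb τ * cutoffProfile 1 2 (τ / L ^ 2) with hH
  have hXc : ContDiff ℝ ∞ (cutoffProfile 1 2) := cutoffProfile_contDiff _ _
  have hHc : ContDiff ℝ ∞ H := hPb.mul (hXc.comp (contDiff_id.div_const _))
  have hX1 : ∀ τ, τ ≤ 1 → cutoffProfile 1 2 τ = 1 := fun τ hτ =>
    cutoffProfile_eq_one zero_le_one one_lt_two (by simpa using hτ)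
  have hX0 : ∀ τ, 4 ≤ τ → cutoffProfile 1 2 τ = 0 := fun τ hτ =>
    cutoffProfile_eq_zero zero_le_one one_lt_two (by norm_num; linarith)
  -- the constant: `|Dφ| ≤ 8LC r⁻²`, `|Δφ| ≤ (16L²C + 6C) r⁻³`
  refine ⟨16 * L ^ 2 * C + 8 * L * C + 6 * C, by positivity, fun r hr x₀ => ?_⟩
  have hr0 : r ≠ 0 := hr.ne'
  -- `φ = g(|x - x₀|²)` with `g(σ) = r⁻¹ H(σ/r²)`
  set g : ℝ → ℝ := fun σ => r⁻¹ * H (σ / r ^ 2) with hg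
  set g₁ : ℝ → ℝ := fun σ => (r ^ 3)⁻¹ * deriv H (σ / r ^ 2) with hg₁
  set g₂ : ℝ → ℝ := fun σ => (r ^ 5)⁻¹ * deriv (deriv H) (σ / r ^ 2) with hg₂
  have hφg : (fun x : EuclideanSpace ℝ (Fin 3) =>
      r⁻¹ * (Pb (‖x - x₀‖ ^ 2 / r ^ 2) * cutoffProfile 1 2 (‖x - x₀‖ ^ 2 / r ^ 2 / L ^ 2))) =
      fun x => g (‖x - x₀‖ ^ 2) := by
    funext x; simp only [hg, hH]
  have hHd : ∀ τ, HasDerivAt H (deriv H τ) τ := fun τ =>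
    ((hHc.differentiable (by simp)) τ).hasDerivAt
  have hd1c : ContDiff ℝ ∞ (deriv H) := (contDiff_infty_iff_deriv.mp hHc).2
  have hH'd : ∀ τ, HasDerivAt (deriv H) (deriv (deriv H) τ) τ := fun τ =>
    ((hd1c.differentiable (by simp)) τ).hasDerivAt
  have hgd : ∀ σ, HasDerivAt g (g₁ σ) σ := by
    intro σ
    have h1 : HasDerivAt (fun σ : ℝ => σ / r ^ 2) (1 / r ^ 2) σ := by
      simpa using (hasDerivAt_id σ).div_const (r ^ 2)
    have h2 := ((hHd (σ / r ^ 2)).comp σ h1).const_mul r⁻¹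
    refine h2.congr_deriv ?_
    simp only [hg₁]
    field_simp
  have hg₁d : ∀ σ, HasDerivAt g₁ (g₂ σ) σ := by
    intro σ
    have h1 : HasDerivAt (fun σ : ℝ => σ / r ^ 2) (1 / r ^ 2) σ := by
      simpa using (hasDerivAt_id σ).div_const (r ^ 2)
    have h2 := ((hH'd (σ / r ^ 2)).comp σ h1).const_mul (r ^ 3)⁻¹
    refine h2.congr_deriv ?_
    simp only [hg₂]
    field_simp
  -- bounds on `g₁`, `g₂` (support in `σ ≤ 4L²r²`)
  have hg₁b : ∀ σ, |g₁ σ| ≤ C / r ^ 3 := fun σ => by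
    have h3 : 0 < (r ^ 3)⁻¹ := inv_pos.2 (pow_pos hr 3)
    calc |g₁ σ| = |(r ^ 3)⁻¹ * deriv H (σ / r ^ 2)| := rfl
      _ = (r ^ 3)⁻¹ * |deriv H (σ / r ^ 2)| := by
          rw [abs_mul ((r ^ 3)⁻¹) (deriv H (σ / r ^ 2)), abs_of_pos h3]
      _ ≤ (r ^ 3)⁻¹ * C := mul_le_mul_of_nonneg_left (hC1 _) h3.le
      _ = C / r ^ 3 := by ring
  have hg₂b : ∀ σ, |g₂ σ| ≤ C / r ^ 5 := fun σ => by
    have h5 : 0 < (r ^ 5)⁻¹ := inv_pos.2 (pow_pos hr 5)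
    calc |g₂ σ| = |(r ^ 5)⁻¹ * deriv (deriv H) (σ / r ^ 2)| := rfl
      _ = (r ^ 5)⁻¹ * |deriv (deriv H) (σ / r ^ 2)| := by
          rw [abs_mul ((r ^ 5)⁻¹) (deriv (deriv H) (σ / r ^ 2)), abs_of_pos h5]
      _ ≤ (r ^ 5)⁻¹ * C := mul_le_mul_of_nonneg_left (hC2 _) h5.le
      _ = C / r ^ 5 := by ring
  have hg₁0 : ∀ σ, 4 * L ^ 2 * r ^ 2 < σ → g₁ σ = 0 := fun σ hσ => by
    simp only [hg₁]
    rw [hd1hi _ (by rw [lt_div_iff₀ (by positivity)]; linarith), mul_zero]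
  have hg₂0 : ∀ σ, 4 * L ^ 2 * r ^ 2 < σ → g₂ σ = 0 := fun σ hσ => by
    simp only [hg₂]
    rw [hd2hi _ (by rw [lt_div_iff₀ (by positivity)]; linarith), mul_zero]
  -- smoothness and values
  have hsmooth : ContDiff ℝ ∞ fun x : EuclideanSpace ℝ (Fin 3) => g (‖x - x₀‖ ^ 2) := by
    have hgc : ContDiff ℝ ∞ g := contDiff_const.mul (hHc.comp (contDiff_id.div_const _))
    exact hgc.comp ((contDiff_norm_sq ℝ).comp (contDiff_id.sub contDiff_const))
  have hval0 : ∀ x : EuclideanSpace ℝ (Fin 3), 2 * L * r ≤ ‖x - x₀‖ → g (‖x - x₀‖ ^ 2) = 0 := by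
    intro x hx
    simp only [hg, hH]
    have hτ : 4 ≤ ‖x - x₀‖ ^ 2 / r ^ 2 / L ^ 2 := by
      rw [le_div_iff₀ (by positivity), le_div_iff₀ (by positivity)]
      nlinarith [hx, mul_pos hL0 hr]
    rw [hX0 _ hτ, mul_zero, mul_zero]
  have hsupp : HasCompactSupport fun x : EuclideanSpace ℝ (Fin 3) => g (‖x - x₀‖ ^ 2) := by
    refine HasCompactSupport.intro (isCompact_closedBall x₀ (2 * L * r)) fun x hx => ?_
    rw [mem_closedBall, dist_eq_norm, not_le] at hx
    exact hval0 x hx.le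
  have htsupp : tsupport (fun x : EuclideanSpace ℝ (Fin 3) => g (‖x - x₀‖ ^ 2)) ⊆
      closedBall x₀ (2 * L * r) := by
    refine closure_minimal (fun x hx => ?_) isClosed_closedBall
    rw [mem_closedBall, dist_eq_norm]
    by_contra hlt
    exact hx (hval0 x (not_le.1 hlt).le)
  -- gradient and Laplacian through `g₁`, `g₂`, at the translated point
  have hDφ : ∀ x a : EuclideanSpace ℝ (Fin 3),
      fderiv ℝ (fun x : EuclideanSpace ℝ (Fin 3) => g (‖x - x₀‖ ^ 2)) x a =
        2 * g₁ (‖x - x₀‖ ^ 2) * ⟪x - x₀, a⟫ := by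
    intro x a
    have ht : fderiv ℝ (fun x : EuclideanSpace ℝ (Fin 3) => g (‖x - x₀‖ ^ 2)) x =
        fderiv ℝ (fun w : EuclideanSpace ℝ (Fin 3) => g (‖w‖ ^ 2)) (x - x₀) := by
      simpa [sub_eq_add_neg] using
        fderiv_comp_add_right (f := fun w : EuclideanSpace ℝ (Fin 3) => g (‖w‖ ^ 2)) (x := x) (-x₀)
    rw [ht, fderiv_comp_norm_sq_apply hgd]
  have hΔφ : ∀ x : EuclideanSpace ℝ (Fin 3),
      (Δ (fun x : EuclideanSpace ℝ (Fin 3) => g (‖x - x₀‖ ^ 2))) x =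
        4 * g₂ (‖x - x₀‖ ^ 2) * ‖x - x₀‖ ^ 2 + 6 * g₁ (‖x - x₀‖ ^ 2) := by
    intro x
    have key : ∀ (f : EuclideanSpace ℝ (Fin 3) → ℝ) (a y : EuclideanSpace ℝ (Fin 3)),
        (Δ (fun y => f (y - a))) y = (Δ f) (y - a) := by
      intro f a y
      rw [InnerProductSpace.laplacian_eq_iteratedFDeriv_stdOrthonormalBasis,
        InnerProductSpace.laplacian_eq_iteratedFDeriv_stdOrthonormalBasis]
      simp only [iteratedFDeriv_comp_sub]
    have ht : (Δ (fun x : EuclideanSpace ℝ (Fin 3) => g (‖x - x₀‖ ^ 2))) x =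
        (Δ (fun w : EuclideanSpace ℝ (Fin 3) => g (‖w‖ ^ 2))) (x - x₀) :=
      key (fun w => g (‖w‖ ^ 2)) x₀ x
    rw [ht, laplacian_comp_norm_sq_fin3 hgd hg₁d]
  rw [hφg]
  refine ⟨hsmooth, hsupp, fun x => ?_, fun x => ?_, htsupp, fun x hx => ?_, fun x => ?_,
    fun x => ?_⟩
  · -- `0 ≤ φ`
    exact mul_nonneg (inv_pos.2 hr).le (mul_nonneg (hPbnn _) (cutoffProfile_nonneg _ _ _))
  · -- `φ ≤ r⁻¹`
    have h1 : Pb (‖x - x₀‖ ^ 2 / r ^ 2) * cutoffProfile 1 2 (‖x - x₀‖ ^ 2 / r ^ 2 / L ^ 2) ≤ 1 :=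
      mul_le_one₀ (hPble _) (cutoffProfile_nonneg _ _ _) (cutoffProfile_le_one _ _ _)
    calc r⁻¹ * (Pb (‖x - x₀‖ ^ 2 / r ^ 2) * cutoffProfile 1 2 (‖x - x₀‖ ^ 2 / r ^ 2 / L ^ 2))
        ≤ r⁻¹ * 1 := mul_le_mul_of_nonneg_left h1 (inv_pos.2 hr).le
      _ = r⁻¹ := mul_one _
  · -- `φ = r⁻¹ P̄` on `|x - x₀| ≤ Lr`
    have hτ : ‖x - x₀‖ ^ 2 / r ^ 2 / L ^ 2 ≤ 1 := by
      rw [div_le_one (by positivity), div_le_iff₀ (by positivity)]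
      nlinarith [hx, norm_nonneg (x - x₀), mul_pos hL0 hr]
    rw [hX1 _ hτ, mul_one]
  · -- the gradient bound
    refine ContinuousLinearMap.opNorm_le_bound _ (by positivity) fun a => ?_
    rw [hDφ x a, Real.norm_eq_abs]
    by_cases hσ : ‖x - x₀‖ ^ 2 ≤ 4 * L ^ 2 * r ^ 2
    · have hxn : ‖x - x₀‖ ≤ 2 * L * r := by
        have : ‖x - x₀‖ ^ 2 ≤ (2 * L * r) ^ 2 := by nlinarith
        exact (pow_le_pow_iff_left₀ (norm_nonneg _) (by positivity) two_ne_zero).1 this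
      calc |2 * g₁ (‖x - x₀‖ ^ 2) * ⟪x - x₀, a⟫|
          = 2 * |g₁ (‖x - x₀‖ ^ 2)| * |⟪x - x₀, a⟫| := by
            rw [abs_mul (2 * g₁ (‖x - x₀‖ ^ 2)) ⟪x - x₀, a⟫, abs_mul (2 : ℝ) (g₁ (‖x - x₀‖ ^ 2)),
              abs_two]
        _ ≤ 2 * (C / r ^ 3) * (‖x - x₀‖ * ‖a‖) := by
            gcongr
            · exact hg₁b _
            · exact abs_real_inner_le_norm _ _
        _ ≤ 2 * (C / r ^ 3) * ((2 * L * r) * ‖a‖) := by gcongr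
        _ = (4 * L * C / r ^ 2) * ‖a‖ := by field_simp; ring
        _ ≤ (16 * L ^ 2 * C + 8 * L * C + 6 * C) / r ^ 2 * ‖a‖ := by
            gcongr
            nlinarith [mul_nonneg (sq_nonneg L) hC0, mul_nonneg hL0.le hC0]
    · rw [hg₁0 _ (not_le.1 hσ)]
      simp only [mul_zero, zero_mul, abs_zero]
      positivity
  · -- the Laplacian bound
    rw [hΔφ x]
    by_cases hσ : ‖x - x₀‖ ^ 2 ≤ 4 * L ^ 2 * r ^ 2
    · calc |4 * g₂ (‖x - x₀‖ ^ 2) * ‖x - x₀‖ ^ 2 + 6 * g₁ (‖x - x₀‖ ^ 2)|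
          ≤ |4 * g₂ (‖x - x₀‖ ^ 2) * ‖x - x₀‖ ^ 2| + |6 * g₁ (‖x - x₀‖ ^ 2)| := abs_add_le _ _
        _ = 4 * |g₂ (‖x - x₀‖ ^ 2)| * ‖x - x₀‖ ^ 2 + 6 * |g₁ (‖x - x₀‖ ^ 2)| := by
            rw [abs_mul (4 * g₂ (‖x - x₀‖ ^ 2)) (‖x - x₀‖ ^ 2), abs_mul (4 : ℝ) (g₂ (‖x - x₀‖ ^ 2)),
              abs_mul (6 : ℝ) (g₁ (‖x - x₀‖ ^ 2)), abs_of_nonneg (sq_nonneg ‖x - x₀‖),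
              abs_of_pos (by norm_num : (0 : ℝ) < 4), abs_of_pos (by norm_num : (0 : ℝ) < 6)]
        _ ≤ 4 * (C / r ^ 5) * (4 * L ^ 2 * r ^ 2) + 6 * (C / r ^ 3) := by
            gcongr
            · exact hg₂b _
            · exact hg₁b _
        _ = (16 * L ^ 2 * C + 6 * C) / r ^ 3 := by field_simp; ring
        _ ≤ (16 * L ^ 2 * C + 8 * L * C + 6 * C) / r ^ 3 := by
            gcongr
            nlinarith [mul_nonneg hL0.le hC0]
    · rw [hg₁0 _ (not_le.1 hσ), hg₂0 _ (not_le.1 hσ)]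
      simp only [mul_zero, zero_mul, add_zero, abs_zero]
      positivity

end SereginSverak2002

end Literature.Analysis.FluidPDE

end
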